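import Literature.AlgebraicGeometry.Modules.FrameTransition
import HarnessLib

/-!
# Frames adapted to a short exact sequence of `𝒪_X`-modules

For a short exact sequence `0 → E₁ → E₂ → E₃ → 0` of `𝒪_X`-modules on a scheme `X` and frames
`e₁ : 𝒪^I ≅ E₁|_W`, `e₃ : 𝒪^K ≅ E₃|_W` over the same open `W` such that the basis sections of `e₃`
lift to sections `t_k ∈ Γ(E₂, W)`, the middle term is free over `W` on the images of the basis of
`e₁` together with the lifts `t_k` (the tree's five-lemma splitting
`SheafOfModules.freeIsoOfShortExact`, `Motives/ChernClassesProofs.lean`). This file names that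
**adapted frame** `adaptedFrame : 𝒪^{I ⊕ K} ≅ E₂|_W` and computes its basis sections
(`basisSection_adaptedFrame_inl`, `basisSection_adaptedFrame_inr`), which is what makes its
transition matrices block upper triangular (`Modules/DeterminantCocycleExact.lean`; Hartshorne II
Ex. 5.16 (d): `Λ^{top} E₂ ≅ Λ^{top} E₁ ⊗ Λ^{top} E₃`). It also records how coordinates and
transition matrices behave under restriction of frames to smaller opens
(`coord_restrictTrivialisation`, `transition_restrictTrivialisation`,
`transitionDet_restrictTrivialisation`). Everything is proved; no named facts.

## References

* R. Hartshorne, *Algebraic Geometry*, GTM 52 (1977), II Ex. 5.7 (b), II Ex. 5.16 (d).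
  [Hartshorne1977]
-/

noncomputable section

open CategoryTheory AlgebraicGeometry Opposite TopologicalSpace Limits

namespace Literature.AlgebraicGeometry.Modules

open Literature.AlgebraicGeometry.Motives

universe u

variable {X : Scheme.{u}}

/-! ### Restricting frames -/

section RestrictFrame

variable {E : X.Modules} {W W' U U' V V' : X.Opens} {I I' : Type u} {n n' : ℕ}
  (e : SheafOfModules.free I ≅ E.over W) (e' : SheafOfModules.free I' ≅ E.over W')

/-- Coordinates in a restricted frame are coordinates in the original frame. [folklore] -/
lemma coord_restrictTrivialisation (k : V ⟶ W) (l : V' ⟶ V) (s : Γ(E, V')) (i : I) :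
    coord (SheafOfModules.restrictTrivialisation (R := X.ringCatSheaf) k e) l s i =
      coord e (l ≫ k) s i := by
  rw [coord_def, coord_def, ← restrictHom_dualBasis, appLE_restrictHom]

/-- Transition matrices of restricted frames are transition matrices of the original frames.
[folklore] -/
lemma transition_restrictTrivialisation (k : U ⟶ W) (k' : U' ⟶ W') (l : V ⟶ U) (l' : V ⟶ U') :
    transition (SheafOfModules.restrictTrivialisation (R := X.ringCatSheaf) k e)
        (SheafOfModules.restrictTrivialisation (R := X.ringCatSheaf) k' e') l l' =
      transition e e' (l ≫ k) (l' ≫ k') := by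
  ext i j
  rw [transition_apply, transition_apply, basisSection_restrictTrivialisation, presheaf_map_map,
    coord_restrictTrivialisation]

/-- Determinants of transition matrices of restricted frames. [folklore] -/
lemma transitionDet_restrictTrivialisation (ε : I ≃ Fin n) (ε' : I' ≃ Fin n') (k : U ⟶ W)
    (k' : U' ⟶ W') (l : V ⟶ U) (l' : V ⟶ U') :
    transitionDet (SheafOfModules.restrictTrivialisation (R := X.ringCatSheaf) k e)
        (SheafOfModules.restrictTrivialisation (R := X.ringCatSheaf) k' e') ε ε' l l' =
      transitionDet e e' ε ε' (l ≫ k) (l' ≫ k') := by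
  unfold transitionDet stdTransition
  rw [transition_restrictTrivialisation]

end RestrictFrame

/-! ### Five-lemma splitting, coproduct form -/

section Coprod

variable {A : Type*} [Category A] [Abelian A]

/-- Coproduct form of the five-lemma splitting `biprodIsoOfShortExact`
(`Motives/ChernClassesProofs.lean`): `A₁ ⨿ A₃ ≅ X₂` for a short exact `0 → X₁ → X₂ → X₃ → 0` with
`A₁ ≅ X₁`, `A₃ ≅ X₃` and a lift `τ : A₃ ⟶ X₂` of `e₃`. [folklore] -/
def coprodIsoOfShortExact {S : ShortComplex A} (hS : S.ShortExact) {A₁ A₃ : A} (e₁ : A₁ ≅ S.X₁)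
    (e₃ : A₃ ≅ S.X₃) (τ : A₃ ⟶ S.X₂) (hτ : τ ≫ S.g = e₃.hom) : A₁ ⨿ A₃ ≅ S.X₂ :=
  (biprod.isoCoprod A₁ A₃).symm ≪≫ biprodIsoOfShortExact hS e₁ e₃ τ hτ

/-- The first coprojection followed by the splitting is `e₁ ≫ f`. [folklore] -/
lemma inl_coprodIsoOfShortExact_hom {S : ShortComplex A} (hS : S.ShortExact) {A₁ A₃ : A}
    (e₁ : A₁ ≅ S.X₁) (e₃ : A₃ ≅ S.X₃) (τ : A₃ ⟶ S.X₂) (hτ : τ ≫ S.g = e₃.hom) :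
    coprod.inl ≫ (coprodIsoOfShortExact hS e₁ e₃ τ hτ).hom = e₁.hom ≫ S.f := by
  simp only [coprodIsoOfShortExact, biprodIsoOfShortExact, Iso.trans_hom, Iso.symm_hom, asIso_hom,
    biprod.isoCoprod_inv, coprod.desc_comp, biprod.inl_desc, biprod.inr_desc]
  exact coprod.inl_desc _ _

/-- The second coprojection followed by the splitting is the lift `τ`. [folklore] -/
lemma inr_coprodIsoOfShortExact_hom {S : ShortComplex A} (hS : S.ShortExact) {A₁ A₃ : A}
    (e₁ : A₁ ≅ S.X₁) (e₃ : A₃ ≅ S.X₃) (τ : A₃ ⟶ S.X₂) (hτ : τ ≫ S.g = e₃.hom) :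
    coprod.inr ≫ (coprodIsoOfShortExact hS e₁ e₃ τ hτ).hom = τ := by
  simp only [coprodIsoOfShortExact, biprodIsoOfShortExact, Iso.trans_hom, Iso.symm_hom, asIso_hom,
    biprod.isoCoprod_inv, coprod.desc_comp, biprod.inl_desc, biprod.inr_desc]
  exact coprod.inr_desc _ _

end Coprod

/-! ### The frame adapted to a short exact sequence -/

section Adapted

variable {S : ShortComplex X.Modules} (hS : S.ShortExact) {W : X.Opens} {I K : Type u}
  (e₁ : SheafOfModules.free I ≅ S.X₁.over W) (e₃ : SheafOfModules.free K ≅ S.X₃.over W)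
  (t : K → Γ(S.X₂, W))

/-- The lifts `t_k`, as sections of `E₂|_W` on the site of opens over `W`, map to the basis sections
of `e₃` under `g|_W`. [folklore] -/
lemma sectionsMap_overSectionsEquiv_symm_lift (ht : ∀ k, S.g.app W (t k) = basisSection e₃ k)
    (k : K) :
    SheafOfModules.sectionsMap (S.map (Scheme.Modules.overFunctor W)).g
        ((Scheme.Modules.overSectionsEquiv S.X₂ W).symm (t k)) =
      (S.map (Scheme.Modules.overFunctor W)).X₃.freeHomEquiv e₃.hom k := by
  apply (Scheme.Modules.overSectionsEquiv S.X₃ W).injective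
  change Scheme.Modules.overSectionsEquiv S.X₃ W (SheafOfModules.sectionsMap
    ((Scheme.Modules.overFunctor W).map S.g) _) = basisSection e₃ k
  rw [Scheme.Modules.overSectionsEquiv_sectionsMap, Equiv.apply_symm_apply, ht k]

/-- **The frame of `E₂|_W` adapted to `0 → E₁ → E₂ → E₃ → 0`**: free on `I ⊕ K`, the `I`-part being
the image of the frame of `E₁|_W` and the `K`-part the chosen lifts of the frame of `E₃|_W`
(the five-lemma splitting `coprodIsoOfShortExact` applied to the restricted sequence, which is short exact by `Scheme.Modules.shortExact_map_overFunctor`; this is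
the tree's `SheafOfModules.freeIsoOfShortExact`, spelled out to control its basis sections).
[cite: Hartshorne1977, II Ex. 5.7 (b)] -/
def adaptedFrame (ht : ∀ k, S.g.app W (t k) = basisSection e₃ k) :
    SheafOfModules.free (I ⊕ K) ≅ S.X₂.over W :=
  (SheafOfModules.freeSumIso I K).symm ≪≫
    coprodIsoOfShortExact (Scheme.Modules.shortExact_map_overFunctor hS W) e₁ e₃
      ((S.map (Scheme.Modules.overFunctor W)).X₂.freeHomEquiv.symm
        fun k => (Scheme.Modules.overSectionsEquiv S.X₂ W).symm (t k)) (by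
      rw [SheafOfModules.freeHomEquiv_symm_comp]
      apply (S.map (Scheme.Modules.overFunctor W)).X₃.freeHomEquiv.injective
      rw [Equiv.apply_symm_apply]
      funext k
      exact sectionsMap_overSectionsEquiv_symm_lift e₃ t ht k)

/-- The `I`-part of the adapted frame is the frame of `E₁|_W` followed by `f|_W`. [folklore] -/
lemma ιFree_inl_comp_adaptedFrame_hom (ht : ∀ k, S.g.app W (t k) = basisSection e₃ k) (i : I) :
    SheafOfModules.ιFree (Sum.inl i) ≫ (adaptedFrame hS e₁ e₃ t ht).hom =
      SheafOfModules.ιFree i ≫ e₁.hom ≫ (S.map (Scheme.Modules.overFunctor W)).f := by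
  rw [← SheafOfModules.ιFree_freeMap Sum.inl i, ← SheafOfModules.inl_freeSumIso_hom]
  simp only [adaptedFrame, Iso.trans_hom, Iso.symm_hom, Category.assoc, Iso.hom_inv_id_assoc]
  congr 1
  exact inl_coprodIsoOfShortExact_hom _ _ _ _ _

/-- The `K`-part of the adapted frame is given by the lifts. [folklore] -/
lemma ιFree_inr_comp_adaptedFrame_hom (ht : ∀ k, S.g.app W (t k) = basisSection e₃ k) (k : K) :
    SheafOfModules.ιFree (Sum.inr k) ≫ (adaptedFrame hS e₁ e₃ t ht).hom =
      SheafOfModules.ιFree k ≫ (S.map (Scheme.Modules.overFunctor W)).X₂.freeHomEquiv.symm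
        (fun k => (Scheme.Modules.overSectionsEquiv S.X₂ W).symm (t k)) := by
  rw [← SheafOfModules.ιFree_freeMap Sum.inr k, ← SheafOfModules.inr_freeSumIso_hom]
  simp only [adaptedFrame, Iso.trans_hom, Iso.symm_hom, Category.assoc, Iso.hom_inv_id_assoc]
  congr 1
  exact inr_coprodIsoOfShortExact_hom _ _ _ _ _

/-- `freeHomEquiv` in terms of `unitHomEquiv` (Mathlib's definition, as a rewrite rule). [folklore] -/
lemma freeHomEquiv_eq_unitHomEquiv {C : Type*} [Category C] {J : GrothendieckTopology C}
    {R : Sheaf J RingCat.{u}} [HasWeakSheafify J AddCommGrpCat.{u}]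
    [J.WEqualsLocallyBijective AddCommGrpCat.{u}] {M : SheafOfModules.{u} R} {I : Type u}
    (f : SheafOfModules.free I ⟶ M) (i : I) :
    M.freeHomEquiv f i = M.unitHomEquiv (SheafOfModules.ιFree i ≫ f) := by
  rw [← SheafOfModules.unitHomEquiv_symm_freeHomEquiv_apply f i, Equiv.apply_symm_apply]

/-- **Basis sections of the adapted frame, `I`-part**: the images under `f` of the basis sections
of `e₁`. [folklore] -/
theorem basisSection_adaptedFrame_inl (ht : ∀ k, S.g.app W (t k) = basisSection e₃ k) (i : I) :
    basisSection (E := S.X₂) (adaptedFrame hS e₁ e₃ t ht) (Sum.inl i) =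
      S.f.app W (basisSection e₁ i) := by
  rw [basisSection, basisSection, freeHomEquiv_eq_unitHomEquiv,
    ιFree_inl_comp_adaptedFrame_hom, freeHomEquiv_eq_unitHomEquiv]
  rfl

/-- **Basis sections of the adapted frame, `K`-part**: the lifts `t_k`. [folklore] -/
theorem basisSection_adaptedFrame_inr (ht : ∀ k, S.g.app W (t k) = basisSection e₃ k) (k : K) :
    basisSection (E := S.X₂) (adaptedFrame hS e₁ e₃ t ht) (Sum.inr k) = t k := by
  rw [basisSection, freeHomEquiv_eq_unitHomEquiv, ιFree_inr_comp_adaptedFrame_hom]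
  change Scheme.Modules.overSectionsEquiv S.X₂ W ((S.X₂.over W).freeHomEquiv
    ((S.X₂.over W).freeHomEquiv.symm
      fun k => (Scheme.Modules.overSectionsEquiv S.X₂ W).symm (t k)) k) = t k
  rw [Equiv.apply_symm_apply, Equiv.apply_symm_apply]

variable [Fintype I] [Fintype K]

/-- A section of `E₂` over `V ≤ W` with given coordinates in the adapted frame. [folklore] -/
lemma coord_adaptedFrame_of_eq_sum (ht : ∀ k, S.g.app W (t k) = basisSection e₃ k) {V : X.Opens}
    (kV : V ⟶ W) (s : Γ(S.X₂, V))
    (a : I → Γ(X, V)) (c : K → Γ(X, V))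
    (hs : s = ∑ i, a i • S.X₂.presheaf.map kV.op (S.f.app W (basisSection e₁ i)) +
      ∑ k, c k • S.X₂.presheaf.map kV.op (t k)) (j : I ⊕ K) :
    coord (adaptedFrame hS e₁ e₃ t ht) kV s j = Sum.elim a c j := by
  have h : s = ∑ j : I ⊕ K, Sum.elim a c j •
      S.X₂.presheaf.map kV.op (basisSection (E := S.X₂) (adaptedFrame hS e₁ e₃ t ht) j) := by
    rw [Fintype.sum_sum_type]
    simp only [Sum.elim_inl, Sum.elim_inr, basisSection_adaptedFrame_inl,
      basisSection_adaptedFrame_inr]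
    exact hs
  rw [h, coord_sum_smul_basisSection]

end Adapted

end Literature.AlgebraicGeometry.Modules

end
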